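import Summits.AtomisticToContinuum.FouriersLaw.Theorems.BondHeatUncertaintyLightConeBondHeatGibbsByParts
import Summits.AtomisticToContinuum.FouriersLaw.Theorems.BondHeatUncertaintyLightConeBondHeatVirialAlgebra

/-!
# `N`-uniform static second moment of the block current under the Gibbs weight

Support file for the crux `OddSectorIrreversibility.SubBallisticWindow` (stmt-AtomisticToContinuum-14070), line
`Sketch`: the registered stub `stub_staticCurrentBound`. For `pinnedChain ω₂ lam β γ` (`ω₂ > 0`, `lam, β ≥ 0`,
`T > 0`), `ρ = e^{-H/T}`, `Z = ∫ ρ`, GIVEN `N`-uniform moments `∫ q_i^{2m} ρ ≤ C_m Z`, the block current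
`J_B = ∑_{k₁ ≤ i < k₂} j_i` has `∫ J_B² ρ ≤ C (k₂ - k₁) Z`: distant currents are orthogonal (`∫ p_b F ρ = 0` when
`F` does not depend on `p_b`, Gaussian integration by parts), neighbours cost `2ab ≤ a² + b²`, and
`∫ j_i² ρ = 2T ∫ V'(r_i)²/4 ρ ≤ 4T(1 + (1 + 16β²)C₃) Z` by the Gaussian momentum identity and the sixth moments.
-/

noncomputable section

open MeasureTheory

namespace Summit.AtomisticToContinuum.FouriersLaw.Theorems.SubBallisticWindow.StaticCurrentBound

open Literature.MathematicalPhysics.KineticTheory.HeatConduction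
open Summit.AtomisticToContinuum.FouriersLaw.Theorems.SubdiffusiveBondHeat
open Summit.AtomisticToContinuum.FouriersLaw.Theorems.LightConeBondHeat

variable {N : ℕ}

/-- Closed form of the bond current on a bond `(i, j)`, `j = i + 1`. [folklore] -/
theorem bondCurrent_eq_of_succ (P : OscillatorChain) {i j : Fin N} (hj : j.val = i.val + 1) (x : PhaseSpace N) :
    P.bondCurrent N i x = -((x.2 i + x.2 j) / 2 * deriv P.V (x.1 j - x.1 i)) := by
  have h : i.val + 1 < N := hj ▸ j.isLt
  rw [bondCurrent_eq_of_lt P h, show (⟨i.val + 1, h⟩ : Fin N) = j from Fin.ext hj.symm]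

/-- The sites `i` with `lo ≤ i < hi` number at most `hi - lo`. [folklore] -/
theorem card_filter_le {lo hi : ℕ} (h : lo ≤ hi) :
    (((Finset.univ.filter fun i : Fin N => lo ≤ i.val ∧ i.val < hi)).card : ℝ) ≤ (hi : ℝ) - lo := by
  have h1 : (Finset.univ.filter fun i : Fin N => lo ≤ i.val ∧ i.val < hi).card ≤ (Finset.Ico lo hi).card :=
    Finset.card_le_card_of_injOn (fun i : Fin N => i.val)
      (fun i hi' => Finset.mem_coe.mpr (Finset.mem_Ico.mpr (Finset.mem_filter.mp (Finset.mem_coe.mp hi')).2))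
      Fin.val_injective.injOn
  rw [Nat.card_Ico] at h1
  have h3 : ((Finset.univ.filter fun i : Fin N => lo ≤ i.val ∧ i.val < hi).card : ℝ) ≤ ((hi - lo : ℕ) : ℝ) := by
    exact_mod_cast h1
  rwa [Nat.cast_sub h] at h3

/-- A banded double sum with nonnegative row weights: if `M i i' ≤ 0` off the band `|i - i'| ≤ 1` and
`M i i' ≤ c i` everywhere, then `∑_{i,i'} M i i' ≤ 3 ∑_i c i`. [folklore] -/
theorem sum_sum_le_of_banded (M : Fin N → Fin N → ℝ) (c : Fin N → ℝ) (hc : ∀ i, 0 ≤ c i)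
    (hfar : ∀ i i', ¬(i.val - 1 ≤ i'.val ∧ i'.val < i.val + 2) → M i i' ≤ 0) (hle : ∀ i i', M i i' ≤ c i) :
    ∑ i, ∑ i', M i i' ≤ 3 * ∑ i, c i := by
  rw [Finset.mul_sum]
  refine Finset.sum_le_sum fun i _ => ?_
  have hcard := card_filter_le (N := N) (show i.val - 1 ≤ i.val + 2 by omega)
  have h3 : ((i.val + 2 : ℕ) : ℝ) ≤ ((i.val - 1 : ℕ) : ℝ) + 3 := by exact_mod_cast (by omega : i.val + 2 ≤ i.val - 1 + 3)
  calc ∑ i', M i i' ≤ ∑ i', (if i.val - 1 ≤ i'.val ∧ i'.val < i.val + 2 then c i else 0) :=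
        Finset.sum_le_sum fun i' _ => by
          split_ifs with h
          · exact hle i i'
          · exact hfar i i' h
    _ = ((Finset.univ.filter fun i' : Fin N => i.val - 1 ≤ i'.val ∧ i'.val < i.val + 2).card : ℝ) * c i := by
        rw [← Finset.sum_filter, Finset.sum_const, nsmul_eq_mul]
    _ ≤ 3 * c i := mul_le_mul_of_nonneg_right (by push_cast at hcard h3 ⊢; linarith) (hc i)

section Pinned

variable {ω₂ lam β : ℝ}

/-- `|p_k| ≤ 1 + H` (`p_k² ≤ 2H`). [folklore] -/
theorem abs_momentum_le (hω : 0 ≤ ω₂) (hl : 0 ≤ lam) (hβ : 0 ≤ β) (γ : ℝ) (N : ℕ) (x : PhaseSpace N) (k : Fin N) :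
    |x.2 k| ≤ 1 + (pinnedChain ω₂ lam β γ).hamiltonian N x := by
  have h := pinnedChain_harmonic_le_hamiltonian (ω₂ := ω₂) hl hβ γ N x
  have h1 : x.2 k ^ 2 / 2 ≤ ∑ j, x.2 j ^ 2 / 2 :=
    Finset.single_le_sum (f := fun j => x.2 j ^ 2 / 2) (fun _ _ => by positivity) (Finset.mem_univ k)
  have h2 : 0 ≤ ∑ j, ω₂ * x.1 j ^ 2 / 2 := Finset.sum_nonneg fun _ _ => by positivity
  linarith [abs_le_half_add_sq_half (x.2 k)]

/-- `p_b F e^{-H/T} ∈ L¹` for a continuous `F = O((1+H)^m)`. [folklore] -/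
theorem integrable_momentum_mul (hω : 0 < ω₂) (hl : 0 ≤ lam) (hβ : 0 ≤ β) (γ : ℝ) (N : ℕ) {T : ℝ} (hT : 0 < T)
    (b : Fin N) {F : PhaseSpace N → ℝ} (hF : Continuous F) {C : ℝ} {m : ℕ}
    (hle : ∀ x, |F x| ≤ C * (1 + (pinnedChain ω₂ lam β γ).hamiltonian N x) ^ m) :
    Integrable fun x => x.2 b * F x * (pinnedChain ω₂ lam β γ).gibbsDensity N T x := by
  refine pinnedChain_integrable_mul_gibbsDensity_of_le_pow hω hl hβ γ N hT (m + 1)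
    ((by fun_prop : Continuous fun x : PhaseSpace N => x.2 b).mul hF) (C := C) fun x => ?_
  have hH0 := pinnedChain_hamiltonian_nonneg hω.le hl hβ γ N x
  have hC0 : 0 ≤ C * (1 + (pinnedChain ω₂ lam β γ).hamiltonian N x) ^ m := (abs_nonneg _).trans (hle x)
  rw [abs_mul]
  calc |x.2 b| * |F x| ≤ (1 + (pinnedChain ω₂ lam β γ).hamiltonian N x) *
        (C * (1 + (pinnedChain ω₂ lam β γ).hamiltonian N x) ^ m) :=
        mul_le_mul (abs_momentum_le hω.le hl hβ γ N x b) (hle x) (abs_nonneg _) (by positivity)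
    _ = C * (1 + (pinnedChain ω₂ lam β γ).hamiltonian N x) ^ (m + 1) := by ring

/-- **Odd momentum moments vanish.** If `F` is continuous, `O((1+H)^m)` and does not depend on `p_b`, then
`∫ p_b F e^{-H/T} dq dp = 0` (integration by parts in `p_b`: `p_b e^{-H/T} = -T ∂_{p_b} e^{-H/T}`). [folklore] -/
theorem integral_momentum_mul_eq_zero (hω : 0 < ω₂) (hl : 0 ≤ lam) (hβ : 0 ≤ β) (γ : ℝ) (N : ℕ) {T : ℝ}
    (hT : 0 < T) (b : Fin N) {F : PhaseSpace N → ℝ} (hF : Continuous F)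
    (hinv : ∀ (x : PhaseSpace N) (t : ℝ), F (x + t • ((0, Pi.single b 1) : PhaseSpace N)) = F x)
    {C : ℝ} {m : ℕ} (hle : ∀ x, |F x| ≤ C * (1 + (pinnedChain ω₂ lam β γ).hamiltonian N x) ^ m) :
    ∫ x, x.2 b * F x * (pinnedChain ω₂ lam β γ).gibbsDensity N T x = 0 := by
  set P := pinnedChain ω₂ lam β γ with hP
  have hpF : Integrable fun x => x.2 b * F x * P.gibbsDensity N T x := integrable_momentum_mul hω hl hβ γ N hT b hF hle
  have hFg' : Integrable fun x => F x * (-(x.2 b / T) * P.gibbsDensity N T x) :=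
    (hpF.const_mul (-T⁻¹)).congr (Filter.Eventually.of_forall fun x => by simp only; ring)
  have hF'g : Integrable fun x => (fun _ : PhaseSpace N => (0 : ℝ)) x * P.gibbsDensity N T x := by simp
  have hFd : ∀ x, HasLineDerivAt ℝ F ((fun _ : PhaseSpace N => (0 : ℝ)) x) x ((0, Pi.single b 1) : PhaseSpace N) := by
    intro x
    show HasDerivAt (fun t : ℝ => F (x + t • ((0, Pi.single b 1) : PhaseSpace N))) 0 0
    simp_rw [hinv x]
    exact hasDerivAt_const 0 (F x)
  have e := integral_mul_eq_neg_of_hasLineDerivAt_of_integrable (F := F) (F' := fun _ : PhaseSpace N => (0 : ℝ))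
    (g := P.gibbsDensity N T) (g' := fun x => -(x.2 b / T) * P.gibbsDensity N T x)
    (v := ((0, Pi.single b 1) : PhaseSpace N)) hF'g hFg'
    (pinnedChain_integrable_mul_gibbsDensity_of_le_pow hω hl hβ γ N hT m hF hle) hFd
    (fun x => P.hasLineDerivAt_gibbsDensity (P.hasLineDerivAt_hamiltonian_unitP N x b))
  have lhs : ∫ x, F x * (-(x.2 b / T) * P.gibbsDensity N T x) = -T⁻¹ * ∫ x, x.2 b * F x * P.gibbsDensity N T x := by
    rw [← integral_const_mul]
    exact integral_congr_ae (Filter.Eventually.of_forall fun x => by ring)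
  rw [lhs] at e
  simp only [zero_mul, integral_zero, neg_zero] at e
  rcases mul_eq_zero.mp e with h | h
  · exact absurd (inv_eq_zero.mp (neg_eq_zero.mp h)) hT.ne'
  · exact h

/-- `j_i j_{i'} e^{-H/T} ∈ L¹`. [folklore] -/
theorem integrable_bondCurrent_mul (hω : 0 < ω₂) (hl : 0 ≤ lam) (hβ : 0 ≤ β) (γ : ℝ) (N : ℕ) {T : ℝ} (hT : 0 < T)
    (i i' : Fin N) : Integrable fun x => (pinnedChain ω₂ lam β γ).bondCurrent N i x *
      (pinnedChain ω₂ lam β γ).bondCurrent N i' x * (pinnedChain ω₂ lam β γ).gibbsDensity N T x := by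
  refine pinnedChain_integrable_mul_gibbsDensity_of_le_pow hω hl hβ γ N hT 4
    ((pinnedChain_continuous_bondCurrent ω₂ lam β γ N i).mul (pinnedChain_continuous_bondCurrent ω₂ lam β γ N i'))
    (C := (N * ((3 + β) / 2)) ^ 2) fun x => ?_
  have hH0 := pinnedChain_hamiltonian_nonneg hω.le hl hβ γ N x
  rw [abs_mul]
  linarith [mul_le_mul (pinnedChain_abs_bondCurrent_le hω.le hl hβ γ N i x) (pinnedChain_abs_bondCurrent_le hω.le hl hβ γ N i' x)
    (abs_nonneg _) (by positivity : (0:ℝ) ≤ N * ((3 + β) / 2 * (1 + (pinnedChain ω₂ lam β γ).hamiltonian N x) ^ 2))]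

/-- **Orthogonality of distant bond currents.** For `i' ≥ i + 2`: `∫ j_i j_{i'} e^{-H/T} = 0`, because
`j_i j_{i'} = p_{i'} F + p_{i'+1} F` with `F = (p_i + p_{i+1}) V'(r_i) V'(r_{i'})/4` independent of `p_{i'}, p_{i'+1}`
and odd momentum moments vanish. [folklore] -/
theorem integral_bondCurrent_mul_eq_zero (hω : 0 < ω₂) (hl : 0 ≤ lam) (hβ : 0 ≤ β) (γ : ℝ) (N : ℕ) {T : ℝ}
    (hT : 0 < T) {i i' : Fin N} (hfar : i.val + 2 ≤ i'.val) :
    ∫ x, (pinnedChain ω₂ lam β γ).bondCurrent N i x * (pinnedChain ω₂ lam β γ).bondCurrent N i' x *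
      (pinnedChain ω₂ lam β γ).gibbsDensity N T x = 0 := by
  set P := pinnedChain ω₂ lam β γ with hP
  by_cases hi' : i'.val + 1 < N
  · obtain ⟨j, hj⟩ : ∃ j : Fin N, j.val = i.val + 1 := ⟨⟨i.val + 1, by omega⟩, rfl⟩
    obtain ⟨j', hj'⟩ : ∃ j' : Fin N, j'.val = i'.val + 1 := ⟨⟨i'.val + 1, hi'⟩, rfl⟩
    have hij : i ≠ j := fun h => by rw [h] at hj; omega
    have hi'i : i ≠ i' := fun h => by rw [h] at hfar; omega
    have hi'j : j ≠ i' := fun h => by rw [h] at hj; omega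
    have hj'i : i ≠ j' := fun h => by rw [h] at hfar; omega
    have hj'j : j ≠ j' := fun h => by rw [h] at hj; omega
    set F : PhaseSpace N → ℝ := fun x => (x.2 i + x.2 j) *
      ((x.1 j - x.1 i + β * (x.1 j - x.1 i) ^ 3) * (x.1 j' - x.1 i' + β * (x.1 j' - x.1 i') ^ 3)) / 4 with hF
    have hFc : Continuous F := by simp only [hF]; fun_prop
    have hFle : ∀ x, |F x| ≤ (3 + β) ^ 2 / 4 * (1 + P.hamiltonian N x) ^ 3 := by
      intro x
      have hH0 := pinnedChain_hamiltonian_nonneg hω.le hl hβ γ N x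
      have hpvv := mul_le_mul (abs_add_le_one_add (pinnedChain_sq_add_sq_le_hamiltonian hω.le hl hβ γ N x hij))
        (mul_le_mul (abs_deriv_V_le hβ (pinnedChain_bond_le_hamiltonian hω.le hl hβ γ N x hj))
          (abs_deriv_V_le hβ (pinnedChain_bond_le_hamiltonian hω.le hl hβ γ N x hj')) (abs_nonneg _) (by positivity))
        (by positivity) (by positivity)
      simp only [hF]
      rw [abs_div, abs_mul, abs_mul, (by norm_num : |(4 : ℝ)| = 4)]
      linarith [hpvv]
    have hinv : ∀ b : Fin N, i ≠ b → j ≠ b → ∀ (x : PhaseSpace N) (t : ℝ),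
        F (x + t • ((0, Pi.single b 1) : PhaseSpace N)) = F x := fun b hib hjb x t => by simp [hF, hib, hjb]
    have hprod : (fun x => P.bondCurrent N i x * P.bondCurrent N i' x * P.gibbsDensity N T x) =
        fun x => x.2 i' * F x * P.gibbsDensity N T x + x.2 j' * F x * P.gibbsDensity N T x := by
      funext x
      rw [bondCurrent_eq_of_succ P hj x, bondCurrent_eq_of_succ P hj' x, hP, pinnedChain_deriv_V, pinnedChain_deriv_V]
      simp only [hF]
      ring
    rw [hprod, integral_add (integrable_momentum_mul hω hl hβ γ N hT i' hFc hFle)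
      (integrable_momentum_mul hω hl hβ γ N hT j' hFc hFle),
      integral_momentum_mul_eq_zero hω hl hβ γ N hT i' hFc (hinv i' hi'i hi'j) hFle,
      integral_momentum_mul_eq_zero hω hl hβ γ N hT j' hFc (hinv j' hj'i hj'j) hFle, add_zero]
  · -- no bond starts at the last site: `j_{i'} = 0`
    have hz : ∀ x, P.bondCurrent N i' x = 0 := fun x =>
      Finset.sum_eq_zero fun j _ => if_neg fun hv : j.val = i'.val + 1 => hi' (hv ▸ j.isLt)
    simp [hz]

/-- `∫ j_i j_{i'} e^{-H/T} ≤ K` as soon as `∫ j_k² e^{-H/T} ≤ K` for all `k` (`2ab ≤ a² + b²`). [folklore] -/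
theorem integral_bondCurrent_mul_le (hω : 0 < ω₂) (hl : 0 ≤ lam) (hβ : 0 ≤ β) (γ : ℝ) (N : ℕ) {T : ℝ} (hT : 0 < T)
    {K : ℝ} (hK : ∀ k : Fin N, ∫ x, ((pinnedChain ω₂ lam β γ).bondCurrent N k x) ^ 2 *
      (pinnedChain ω₂ lam β γ).gibbsDensity N T x ≤ K) (i i' : Fin N) :
    ∫ x, (pinnedChain ω₂ lam β γ).bondCurrent N i x * (pinnedChain ω₂ lam β γ).bondCurrent N i' x *
      (pinnedChain ω₂ lam β γ).gibbsDensity N T x ≤ K := by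
  set P := pinnedChain ω₂ lam β γ with hP
  have hpt : ∀ x, P.bondCurrent N i x * P.bondCurrent N i' x * P.gibbsDensity N T x ≤
      ((P.bondCurrent N i x) ^ 2 * P.gibbsDensity N T x + (P.bondCurrent N i' x) ^ 2 * P.gibbsDensity N T x) / 2 :=
    fun x => by
      nlinarith [mul_nonneg (sq_nonneg (P.bondCurrent N i x - P.bondCurrent N i' x)) (P.gibbsDensity_pos N T x).le]
  have hsq : ∀ k : Fin N, Integrable fun x => (P.bondCurrent N k x) ^ 2 * P.gibbsDensity N T x := fun k =>
    (integrable_bondCurrent_mul hω hl hβ γ N hT k k).congr (Filter.Eventually.of_forall fun x => by simp only [hP]; ring)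
  have hss : Integrable fun x => (P.bondCurrent N i x) ^ 2 * P.gibbsDensity N T x +
      (P.bondCurrent N i' x) ^ 2 * P.gibbsDensity N T x := (hsq i).add (hsq i')
  calc ∫ x, P.bondCurrent N i x * P.bondCurrent N i' x * P.gibbsDensity N T x
      ≤ ∫ x, ((P.bondCurrent N i x) ^ 2 * P.gibbsDensity N T x + (P.bondCurrent N i' x) ^ 2 * P.gibbsDensity N T x) / 2 :=
        integral_mono (integrable_bondCurrent_mul hω hl hβ γ N hT i i') (hss.div_const 2) hpt
    _ = ((∫ x, (P.bondCurrent N i x) ^ 2 * P.gibbsDensity N T x) + ∫ x, (P.bondCurrent N i' x) ^ 2 * P.gibbsDensity N T x) / 2 := by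
        rw [integral_div, integral_add (hsq i) (hsq i')]
    _ ≤ K := by linarith [hK i, hK i']

/-- `q_k⁶ e^{-H/T} ∈ L¹` (`q_k⁶ ≤ (2/ω₂)³ (1+H)³`). [folklore] -/
theorem integrable_position_pow_six (hω : 0 < ω₂) (hl : 0 ≤ lam) (hβ : 0 ≤ β) (γ : ℝ) (N : ℕ) {T : ℝ} (hT : 0 < T)
    (k : Fin N) : Integrable fun x => x.1 k ^ 6 * (pinnedChain ω₂ lam β γ).gibbsDensity N T x := by
  refine pinnedChain_integrable_mul_gibbsDensity_of_le_pow hω hl hβ γ N hT 3 (by fun_prop) (C := (2 / ω₂) ^ 3) fun x => ?_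
  have hU := pinnedChain_U_le_hamiltonian hω.le hl hβ γ N x k
  have hq2 : x.1 k ^ 2 ≤ 2 / ω₂ * (1 + (pinnedChain ω₂ lam β γ).hamiltonian N x) := by
    rw [div_mul_eq_mul_div, le_div_iff₀ hω]
    nlinarith [mul_nonneg hl (by positivity : (0:ℝ) ≤ x.1 k ^ 4)]
  rw [abs_of_nonneg (by positivity), show x.1 k ^ 6 = (x.1 k ^ 2) ^ 3 by ring, ← mul_pow]
  exact pow_le_pow_left₀ (sq_nonneg _) hq2 3

/-- **One bond.** If `∫ q_k⁶ ρ ≤ C₃ ∫ ρ` for all sites `k` (`ρ = e^{-H/T}`, `C₃ ≥ 0`), then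
`∫ j_i² ρ ≤ 4T (1 + (1 + 16β²) C₃) ∫ ρ`: `∫ j_i² ρ = 2T ∫ V'(r_i)²/4 ρ` by the Gaussian momentum identity (the cross
term `∫ p_i p_{i+1} G(q) ρ` vanishes), and `V'(r)²/4 ≤ (r² + β²r⁶)/2 ≤ 2 + (1 + 16β²)(q_i⁶ + q_{i+1}⁶)`
(`r² ≤ 2(q_i² + q_{i+1}²)`, `q² ≤ 1 + q⁶`, `r⁶ ≤ 32(q_i⁶ + q_{i+1}⁶)`). [folklore] -/
theorem integral_sq_bondCurrent_le (hω : 0 < ω₂) (hl : 0 ≤ lam) (hβ : 0 ≤ β) (γ : ℝ) (N : ℕ) {T : ℝ} (hT : 0 < T)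
    {C₃ : ℝ} (hC₃ : 0 ≤ C₃) (hq6 : ∀ k : Fin N, ∫ x, x.1 k ^ 6 * (pinnedChain ω₂ lam β γ).gibbsDensity N T x ≤
      C₃ * ∫ x, (pinnedChain ω₂ lam β γ).gibbsDensity N T x) (i : Fin N) :
    ∫ x, ((pinnedChain ω₂ lam β γ).bondCurrent N i x) ^ 2 * (pinnedChain ω₂ lam β γ).gibbsDensity N T x ≤
      4 * T * (1 + (1 + 16 * β ^ 2) * C₃) * ∫ x, (pinnedChain ω₂ lam β γ).gibbsDensity N T x := by
  set P := pinnedChain ω₂ lam β γ with hP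
  have hZi : Integrable fun x => P.gibbsDensity N T x := pinnedChain_integrable_gibbsDensity hω hl hβ γ N hT
  have hZ : 0 ≤ ∫ x, P.gibbsDensity N T x := integral_nonneg fun x => (P.gibbsDensity_pos N T x).le
  by_cases hi : i.val + 1 < N
  · obtain ⟨j, hj⟩ : ∃ j : Fin N, j.val = i.val + 1 := ⟨⟨i.val + 1, hi⟩, rfl⟩
    have hij : i ≠ j := fun h => by rw [h] at hj; omega
    set G : (Fin N → ℝ) → ℝ := fun q => (q j - q i + β * (q j - q i) ^ 3) ^ 2 / 4 with hG
    have hGc : Continuous G := by simp only [hG]; fun_prop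
    have hGle : ∀ x : PhaseSpace N, |G x.1| ≤ (3 + β) ^ 2 / 4 * (1 + P.hamiltonian N x) ^ 2 := by
      intro x
      have hv := pow_le_pow_left₀ (abs_nonneg _) (abs_deriv_V_le hβ (pinnedChain_bond_le_hamiltonian hω.le hl hβ γ N x hj)) 2
      rw [sq_abs] at hv
      simp only [hG]
      rw [abs_of_nonneg (by positivity)]
      linarith [hv]
    obtain ⟨hGi, -, hGi2⟩ := pinnedChain_integrable_momentum_pow_mul_posFun hω hl hβ γ N hT i hGc hGle
    obtain ⟨-, -, hGj2⟩ := pinnedChain_integrable_momentum_pow_mul_posFun hω hl hβ γ N hT j hGc hGle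
    -- the cross term `2 p_i (p_j G(q))` integrates to zero
    have hFc : Continuous fun x : PhaseSpace N => x.2 j * G x.1 :=
      (by fun_prop : Continuous fun x : PhaseSpace N => x.2 j).mul (hGc.comp continuous_fst)
    have hFle : ∀ x : PhaseSpace N, |x.2 j * G x.1| ≤ (3 + β) ^ 2 / 4 * (1 + P.hamiltonian N x) ^ 3 := by
      intro x
      have hH0 := pinnedChain_hamiltonian_nonneg hω.le hl hβ γ N x
      rw [abs_mul]
      linarith [mul_le_mul (abs_momentum_le hω.le hl hβ γ N x j) (hGle x) (abs_nonneg _) (by positivity : 0 ≤ 1 + P.hamiltonian N x)]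
    have hcross : ∫ x, x.2 i * (x.2 j * G x.1) * P.gibbsDensity N T x = 0 :=
      integral_momentum_mul_eq_zero hω hl hβ γ N hT i hFc (fun x t => by simp [hij.symm]) hFle
    have hcross2 : Integrable fun x => 2 * (x.2 i * (x.2 j * G x.1) * P.gibbsDensity N T x) :=
      (integrable_momentum_mul hω hl hβ γ N hT i hFc hFle).const_mul 2
    have h12 : Integrable fun x => x.2 i ^ 2 * G x.1 * P.gibbsDensity N T x +
        2 * (x.2 i * (x.2 j * G x.1) * P.gibbsDensity N T x) := hGi2.add hcross2
    have hexp : (fun x => (P.bondCurrent N i x) ^ 2 * P.gibbsDensity N T x) = fun x => x.2 i ^ 2 * G x.1 * P.gibbsDensity N T x +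
        2 * (x.2 i * (x.2 j * G x.1) * P.gibbsDensity N T x) + x.2 j ^ 2 * G x.1 * P.gibbsDensity N T x := by
      funext x
      rw [bondCurrent_eq_of_succ P hj x, hP, pinnedChain_deriv_V]
      simp only [hG]
      ring
    rw [hexp, integral_add h12 hGj2, integral_add hGi2 hcross2, integral_const_mul, hcross, mul_zero, add_zero,
      pinnedChain_integral_momentum_sq_mul_posFun hω hl hβ γ N hT i hGc hGle,
      pinnedChain_integral_momentum_sq_mul_posFun hω hl hβ γ N hT j hGc hGle]
    -- the configurational integral `∫ G ρ ≤ 2 (1 + (1 + 16β²) C₃) ∫ ρ`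
    have hI6i := integrable_position_pow_six hω hl hβ γ N hT i
    have hI6j := integrable_position_pow_six hω hl hβ γ N hT j
    have hI66 : Integrable fun x : PhaseSpace N =>
        (1 + 16 * β ^ 2) * (x.1 i ^ 6 * P.gibbsDensity N T x + x.1 j ^ 6 * P.gibbsDensity N T x) := (hI6i.add hI6j).const_mul _
    have hIall : Integrable fun x : PhaseSpace N => 2 * P.gibbsDensity N T x +
        (1 + 16 * β ^ 2) * (x.1 i ^ 6 * P.gibbsDensity N T x + x.1 j ^ 6 * P.gibbsDensity N T x) := (hZi.const_mul 2).add hI66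
    have h36 : ∀ t : ℝ, t ^ 2 ≤ 1 + t ^ 6 := fun t => by nlinarith [sq_nonneg (t ^ 2 - 1), sq_nonneg (t ^ 3), sq_nonneg t]
    have hpt : ∀ x : PhaseSpace N, G x.1 * P.gibbsDensity N T x ≤ 2 * P.gibbsDensity N T x +
        (1 + 16 * β ^ 2) * (x.1 i ^ 6 * P.gibbsDensity N T x + x.1 j ^ 6 * P.gibbsDensity N T x) := by
      intro x
      have hGpt : G x.1 ≤ 2 + (1 + 16 * β ^ 2) * (x.1 i ^ 6 + x.1 j ^ 6) := by
        have h1 : (x.1 j - x.1 i + β * (x.1 j - x.1 i) ^ 3) ^ 2 ≤ 2 * (x.1 j - x.1 i) ^ 2 + 2 * (β ^ 2 * (x.1 j - x.1 i) ^ 6) := by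
          nlinarith [sq_nonneg (x.1 j - x.1 i - β * (x.1 j - x.1 i) ^ 3)]
        have h2 : (x.1 j - x.1 i) ^ 2 ≤ 2 * (x.1 j ^ 2 + x.1 i ^ 2) := by nlinarith [sq_nonneg (x.1 j + x.1 i)]
        have h5 : β ^ 2 * (x.1 j - x.1 i) ^ 6 ≤ β ^ 2 * (32 * (x.1 i ^ 6 + x.1 j ^ 6)) :=
          mul_le_mul_of_nonneg_left (sub_pow_six_le (x.1 i) (x.1 j)) (sq_nonneg β)
        simp only [hG]
        nlinarith [h1, h2, h36 (x.1 i), h36 (x.1 j), h5, sq_nonneg (x.1 i ^ 3), sq_nonneg (x.1 j ^ 3)]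
      nlinarith [mul_le_mul_of_nonneg_right hGpt (P.gibbsDensity_pos N T x).le]
    have hmono := integral_mono hGi hIall hpt
    rw [integral_add (hZi.const_mul 2) hI66, integral_const_mul, integral_const_mul, integral_add hI6i hI6j] at hmono
    have h66 := mul_le_mul_of_nonneg_left (add_le_add (hq6 i) (hq6 j)) (by positivity : (0:ℝ) ≤ 1 + 16 * β ^ 2)
    have hGbound : ∫ x, G x.1 * P.gibbsDensity N T x ≤ 2 * (1 + (1 + 16 * β ^ 2) * C₃) * ∫ x, P.gibbsDensity N T x := by
      linarith [hmono, h66]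
    linarith [mul_le_mul_of_nonneg_left hGbound hT.le]
  · have h0 : 0 ≤ 4 * T * (1 + (1 + 16 * β ^ 2) * C₃) * ∫ x, P.gibbsDensity N T x := by positivity
    have hz : ∀ x, P.bondCurrent N i x = 0 := fun x =>
      Finset.sum_eq_zero fun j _ => if_neg fun hv : j.val = i.val + 1 => hi (hv ▸ j.isLt)
    simpa [hz] using h0

/-- **Block current.** If `∫ j_i² e^{-H/T} ≤ K` (`K ≥ 0`) for every `i`, then `∫ J_B² e^{-H/T} ≤ 3K(k₂ - k₁)` for
`J_B = ∑_{k₁ ≤ i < k₂} j_i`: distant currents are orthogonal, neighbours cost `2ab ≤ a² + b²`, and each row of the band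
`|i - i'| ≤ 1` has at most three entries. [folklore] -/
theorem integral_sq_blockCurrent_le (hω : 0 < ω₂) (hl : 0 ≤ lam) (hβ : 0 ≤ β) (γ : ℝ) (N : ℕ) {T : ℝ} (hT : 0 < T)
    {K : ℝ} (hK0 : 0 ≤ K) (hK : ∀ i : Fin N, ∫ x, ((pinnedChain ω₂ lam β γ).bondCurrent N i x) ^ 2 *
      (pinnedChain ω₂ lam β γ).gibbsDensity N T x ≤ K) {k₁ k₂ : ℕ} (hk : k₁ ≤ k₂) :
    ∫ x, (∑ i : Fin N, (if k₁ ≤ i.val ∧ i.val < k₂ then (pinnedChain ω₂ lam β γ).bondCurrent N i x else 0)) ^ 2 *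
      (pinnedChain ω₂ lam β γ).gibbsDensity N T x ≤ 3 * K * ((k₂ : ℝ) - k₁) := by
  set P := pinnedChain ω₂ lam β γ with hP
  set ε : Fin N → ℝ := fun i => if k₁ ≤ i.val ∧ i.val < k₂ then 1 else 0 with hε
  have hε01 : ∀ i, 0 ≤ ε i ∧ ε i ≤ 1 := fun i => by simp only [hε]; split_ifs <;> norm_num
  have hexp : ∀ x, (∑ i : Fin N, (if k₁ ≤ i.val ∧ i.val < k₂ then P.bondCurrent N i x else 0)) ^ 2 * P.gibbsDensity N T x =
      ∑ i, ∑ i', ε i * ε i' * (P.bondCurrent N i x * P.bondCurrent N i' x * P.gibbsDensity N T x) := by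
    intro x
    rw [sq, Finset.sum_mul_sum, Finset.sum_mul]
    refine Finset.sum_congr rfl fun i _ => ?_
    rw [Finset.sum_mul]
    refine Finset.sum_congr rfl fun i' _ => ?_
    simp only [hε]
    split_ifs <;> ring
  have hint : ∀ i i', Integrable fun x => ε i * ε i' * (P.bondCurrent N i x * P.bondCurrent N i' x * P.gibbsDensity N T x) :=
    fun i i' => (integrable_bondCurrent_mul hω hl hβ γ N hT i i').const_mul _
  calc ∫ x, (∑ i : Fin N, (if k₁ ≤ i.val ∧ i.val < k₂ then P.bondCurrent N i x else 0)) ^ 2 * P.gibbsDensity N T x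
      = ∫ x, ∑ i, ∑ i', ε i * ε i' * (P.bondCurrent N i x * P.bondCurrent N i' x * P.gibbsDensity N T x) :=
        integral_congr_ae (Filter.Eventually.of_forall hexp)
    _ = ∑ i, ∑ i', ε i * ε i' * ∫ x, P.bondCurrent N i x * P.bondCurrent N i' x * P.gibbsDensity N T x := by
        rw [integral_finsetSum _ fun i _ => integrable_finsetSum _ fun i' _ => hint i i']
        refine Finset.sum_congr rfl fun i _ => ?_
        rw [integral_finsetSum _ fun i' _ => hint i i']
        exact Finset.sum_congr rfl fun i' _ => integral_const_mul _ _
    _ ≤ 3 * ∑ i, ε i * K := by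
        refine sum_sum_le_of_banded _ _ (fun i => mul_nonneg (hε01 i).1 hK0) (fun i i' hfar => ?_) (fun i i' => ?_)
        · have h0 : ∫ x, P.bondCurrent N i x * P.bondCurrent N i' x * P.gibbsDensity N T x = 0 := by
            rcases not_and_or.mp hfar with h | h
            · rw [show (fun x => P.bondCurrent N i x * P.bondCurrent N i' x * P.gibbsDensity N T x) =
                  fun x => P.bondCurrent N i' x * P.bondCurrent N i x * P.gibbsDensity N T x from funext fun x => by ring]
              exact integral_bondCurrent_mul_eq_zero hω hl hβ γ N hT (by omega)
            · exact integral_bondCurrent_mul_eq_zero hω hl hβ γ N hT (by omega)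
          rw [h0, mul_zero]
        · nlinarith [integral_bondCurrent_mul_le hω hl hβ γ N hT hK i i', mul_nonneg (hε01 i).1 (hε01 i').1,
            mul_nonneg (hε01 i).1 hK0, (hε01 i').2]
    _ = 3 * K * ((Finset.univ.filter fun i : Fin N => k₁ ≤ i.val ∧ i.val < k₂).card : ℝ) := by
        rw [← Finset.sum_mul]
        simp only [hε]
        rw [Finset.sum_boole]
        ring
    _ ≤ 3 * K * ((k₂ : ℝ) - k₁) := mul_le_mul_of_nonneg_left (card_filter_le hk) (by positivity)

end Pinned

/-- Integrals against the Gibbs weight `e^{-H/T} dq dp` (spelled with `withDensity`, as in the crux) are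
`e^{-H/T}`-weighted Lebesgue integrals. [folklore] -/
theorem integral_gibbsWeight_eq (ω₂ lam β γ : ℝ) (N : ℕ) (T : ℝ) (f : PhaseSpace N → ℝ) :
    ∫ x, f x ∂(volume.withDensity fun x : PhaseSpace N =>
        ENNReal.ofReal (Real.exp (-((pinnedChain ω₂ lam β γ).hamiltonian N x) / T))) =
      ∫ x, f x * (pinnedChain ω₂ lam β γ).gibbsDensity N T x := by
  have hmeas : Measurable fun x : PhaseSpace N => ENNReal.ofReal (Real.exp (-((pinnedChain ω₂ lam β γ).hamiltonian N x) / T)) := by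
    have := pinnedChain_continuous_hamiltonian ω₂ lam β γ N
    fun_prop
  rw [integral_withDensity_eq_integral_toReal_smul hmeas (Filter.Eventually.of_forall fun _ => ENNReal.ofReal_lt_top)]
  refine integral_congr_ae (Filter.Eventually.of_forall fun x => ?_)
  simp only [ENNReal.toReal_ofReal (Real.exp_pos _).le, smul_eq_mul]
  exact mul_comm _ _

/-- **Stub `stub_staticCurrentBound`** (N-uniform static second moment of the block current; statics). Given
the moment bounds of `stub_gibbsMoments` (taken as the hypothesis, verbatim), there is `C = C(β, T, C₃)` with
`∫ J_B² dμ ≤ C (k₂ − k₁) Z` for ALL `N` and all blocks `k₁ ≤ k₂` (`μ = e^{-H/T} dq dp`, `Z = ∫ e^{-H/T}`,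
`J_B = ∑_{k₁ ≤ i < k₂} j_i`). Route: `∫ j_i j_{i'} dμ = 0` for `|i − i'| ≥ 2` (Gaussian integration by parts in one
momentum), `2 ∫ j_i j_{i'} ≤ ∫ j_i² + ∫ j_{i'}²` for the neighbours, hence `∫ J_B² ≤ 3 (k₂ − k₁) max_i ∫ j_i²`, and
`∫ j_i² dμ = 2T ∫ V'(r_i)²/4 dμ ≤ 4T (1 + (1 + 16β²) C₃) Z` by the Gaussian momentum identity and the sixth position
moments. [folklore] -/
theorem stub_staticCurrentBound :
    ∀ ω₂ lam β γ : ℝ, 0 < ω₂ → 0 ≤ lam → 0 ≤ β → ∀ T : ℝ, 0 < T →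
      (∀ m : ℕ, ∃ C : ℝ, ∀ (N : ℕ) (i : Fin N),
        ∫ x, (x.1 i) ^ (2 * m) ∂(volume.withDensity fun x : PhaseSpace N => ENNReal.ofReal (Real.exp (-((pinnedChain ω₂ lam β γ).hamiltonian N x) / T)))
            ≤ C * (∫ x : PhaseSpace N, Real.exp (-((pinnedChain ω₂ lam β γ).hamiltonian N x) / T)) ∧
        ∫ x, (x.2 i) ^ (2 * m) ∂(volume.withDensity fun x : PhaseSpace N => ENNReal.ofReal (Real.exp (-((pinnedChain ω₂ lam β γ).hamiltonian N x) / T)))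
            ≤ C * (∫ x : PhaseSpace N, Real.exp (-((pinnedChain ω₂ lam β γ).hamiltonian N x) / T))) →
      ∃ C : ℝ, ∀ (N k₁ k₂ : ℕ), k₁ ≤ k₂ →
        ∫ x, ((fun z : PhaseSpace N => ∑ i : Fin N, (if k₁ ≤ i.val ∧ i.val < k₂ then (pinnedChain ω₂ lam β γ).bondCurrent N i z else 0)) x) ^ 2
          ∂(volume.withDensity fun x : PhaseSpace N => ENNReal.ofReal (Real.exp (-((pinnedChain ω₂ lam β γ).hamiltonian N x) / T))) ≤
          C * ((k₂ : ℝ) - k₁) * (∫ x : PhaseSpace N, Real.exp (-((pinnedChain ω₂ lam β γ).hamiltonian N x) / T)) := by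
  intro ω₂ lam β γ hω hl hβ T hT hM
  obtain ⟨C₃, hC₃⟩ := hM 3
  refine ⟨3 * (4 * T * (1 + (1 + 16 * β ^ 2) * max C₃ 0)), fun N k₁ k₂ hk => ?_⟩
  have hZ0 : 0 ≤ ∫ x : PhaseSpace N, Real.exp (-((pinnedChain ω₂ lam β γ).hamiltonian N x) / T) :=
    integral_nonneg fun x => (Real.exp_pos _).le
  have hq6 : ∀ k : Fin N, ∫ x, x.1 k ^ 6 * (pinnedChain ω₂ lam β γ).gibbsDensity N T x ≤
      max C₃ 0 * ∫ x : PhaseSpace N, Real.exp (-((pinnedChain ω₂ lam β γ).hamiltonian N x) / T) := by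
    intro k
    have h := (hC₃ N k).1
    rw [integral_gibbsWeight_eq] at h
    simp only [Nat.reduceMul] at h
    exact h.trans (mul_le_mul_of_nonneg_right (le_max_left _ _) hZ0)
  have hC0 : 0 ≤ max C₃ 0 := le_max_right _ _
  have hK0 : 0 ≤ 4 * T * (1 + (1 + 16 * β ^ 2) * max C₃ 0) *
      ∫ x : PhaseSpace N, Real.exp (-((pinnedChain ω₂ lam β γ).hamiltonian N x) / T) := by positivity
  rw [integral_gibbsWeight_eq]
  refine (integral_sq_blockCurrent_le hω hl hβ γ N hT hK0 (integral_sq_bondCurrent_le hω hl hβ γ N hT hC0 hq6) hk).trans_eq ?_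
  ring

end Summit.AtomisticToContinuum.FouriersLaw.Theorems.SubBallisticWindow.StaticCurrentBound
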